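import Mathlib
import HarnessLib
import HarnessLib.Audit
import Summits.CriticalPhenomena.Statement
import Literature.Probability.RandomPlanarGeometry.ChordalCurveFamily
import HarnessLib.Audit.Status.Attr

/-!
Route: CardyIKTransport

DORMANT since 2026-08-26T07:51:30Z (reconciler: no traction for 8.4 d (last activity item-evidence-added at 2026-08-17T21:54:40Z); parked, not closed — `ledger route dormant route-CriticalPhenomena-CardyIKTransport --off` to reactivate) — unstaffed, not closed; items shared with open routes are served there. `ledger route dormant <id> --off` reactivates.

# Route CardyIKTransport — slide site-T through the isotropic Izergin–Korepin model by
block-resampling exchanges; D4 + modulus rigidity pins the linear map; descend the corner-fugacity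
line to bond-Z^2

It suffices to show X = X₁-inputs ∧ X₂ (card ik-isotropic-cle6-transport, spine; the descent X₂ is
the crux the card shares with
corner-fugacity-plane), now fully TYPED over the explicit i.i.d.-bit gauge of the isotropic
Izergin–Korepin point shared verbatim with
route CardyDiluteOrbit (stmt-CriticalPhenomena-5911/5913; model read back symbol by symbol by two
refuter reviews): colour(v) = A_{v0} ⊕ B_{v1} ⊕
parity of the Bernoulli(2√3−3) plaquette defects in the rectangle between 0 and v (every box
marginal is the free corner-fugacity field with
t = p/(1−p) = √3/2), fair saddle coins choosing one diagonal per face, crude embedded crossing event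
embDomainCrossing with cells at
v0 + i v1; call its crossing probabilities P_IK R δ. X₁ (CARDY FOR THE ISOTROPIC IZERGIN–KOREPIN
MODEL): the n = 1 dilute A₂⁽²⁾
(Izergin–Korepin) model IK(u) on δℤ², u ∈ [π/3, 2π/3] — corner fugacity t(u) = √3/(2 sin u), saddle
bias b(u) = sin(2π/3 − u)/sin u — is,
at u = π/3, site percolation on the triangular lattice drawn with one fixed diagonal (eight tiles of
weight 1, the ninth 0), and at u = π/2
the D₄-symmetric model P_IK; transporting Smirnov's theorem (PROVED in the tree:
hasCrossingLimit_triDomainCrossingProb_holds, axioms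
propext/Classical.choice/Quot.sound; filed as the one-line support item SmirnovCardyTri = stmt-6432)
from u = π/3 to u = π/2 through the
commuting family by two-row block-resampling exchanges (Manolescu's "universality up to linear
deformation", Thm 5.4, re-run outside the
isoradial class) gives IKLinearTransport: P_IK ≃ site-𝕋 ∘ K for an unknown real-linear K; the exact
quarter-turn symmetry of P_IK
(IKQuarterTurn, support, a finite-δ identity) against the conformal invariance of the site-𝕋 limit
forces K to be a similarity
(AnchorByRigidity ⇐ SimilarityRigidity, supports, provable now), hence Cardy's formula for P_IK in
every conformal rectangle
(= CardyDiluteOrbit's CardyIK, stmt-5913, by `exact`). X₂ (DESCENT, CornerLineDescent): Cardy for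
P_IK in every conformal rectangle implies
Cardy for the crude bond-ℤ² crossing event at p = ½ on the standard embedding, in every conformal
rectangle — mechanism: corner
irrelevance along the exactly self-dual, D₄-symmetric line b = ½ of the corner-fugacity plane down
to t = 0, where the model IS bond-ℤ² on a
renewal grid in the slack-free CELL picture, then homogenisation of the renewal grid; the statement
is put at the standard embedding because
the crude event's fixed 2δ endpoint slack is a.s. empty infinitely often along δ → 0⁺ on sparse
product grids (hazard note on stmt-5077 by the
retriage seat, 2026-08-15) — and CrudeToCanonical carries it to G02's discretisation.
Lean: `Summit.CriticalPhenomena.CardyFormulaZ2.Theses.CardyIKTransport.IKLinearTransport ∧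
Summit.CriticalPhenomena.CardyFormulaZ2.Theses.CardyIKTransport.IKQuarterTurn ∧
Summit.CriticalPhenomena.CardyFormulaZ2.Theses.CardyIKTransport.CornerLineDescent` (deciding
theorem, certified sorry-free with standard axioms: `theorem closes : IKLinearTransport →
CornerLineDescent → CrudeToCanonical → IKQuarterTurn → SmirnovCardyTri → AnchorByRigidity →
_root_.CardyFormulaZ2`).

## Assembly
The deciding theorem `closes` (D-0027 §2.1) is four lines of logic: obtain K from IKLinearTransport;
AnchorByRigidity applied to SmirnovCardyTri,
P := P_IK (unified from IKLinearTransport's conjugacy clause), K and IKQuarterTurn gives Cardy for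
P_IK in every conformal rectangle;
CornerLineDescent turns that into Cardy for the crude bond-ℤ² event on the standard embedding;
CrudeToCanonical gives bondDomainCrossingProb,
i.e. `_root_.CardyFormulaZ2` by `exact`. IKMixedBoxCrossing (r4, shared with CardyDiluteOrbit as
stmt-5911) and SimilarityRigidity are inputs
of the proofs of IKLinearTransport and AnchorByRigidity respectively, and RenewalGridHarmless
(stmt-4967, demoted to support) is the optional
product-grid variant of the last step — none of the three is a hypothesis of `closes`. Item
bookkeeping forced by the gate: `Assembly`
(stmt-4971) keeps the opening seat's abstract-P frame (typed, true, provable; assembly items cannot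
be restated while two exist) and
`Assembly2` (stmt-5077, mis-registered at open as kind assembly and undroppable) now carries the
typed chain
`IKLinearTransport → CornerLineDescent → CrudeToCanonical → IKQuarterTurn → SmirnovCardyTri →
AnchorByRigidity → CardyFormulaZ2`, provable by
`exact closes`; an operator drop of one of the two clears route.multi-assembly.

Rationale: WHY THIS LINE. Manolescu2025 (arXiv:2502.08394, Thm 5.4 p. 73; "only uses qualitative features of
critical FK-percolation and the star–triangle
transformation", p. 74) transports the large-scale geometry of critical FK percolation between
isoradial embeddings of ℤ² up to an
unidentified linear map, and closes the ambiguity for ℤ² by an extra symmetry (§5.4.2); Rem. 5.6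
(pp. 74–75) asks for
"additional transformations that allow to exit the class of isoradial graphs". The A₂⁽²⁾ commuting
family does exactly that and
STARTS FROM A THEOREM OF THE TREE: its λ = u = π/3 member is Smirnov's site percolation on 𝕋
(MorinDuchesneKlumperPearce2023 =
arXiv:2211.12379 §2.2, §3.6: eight tiles of weight 1, the ninth 0; isotropic point u = 3λ/2 = π/2),
and Smirnov's theorem is PROVED in the
tree (Literature.Probability.Percolation.hasCrossingLimit_triDomainCrossingProb_holds, axioms
propext/Classical.choice/Quot.sound, re-checked
by this seat; filed as the one-line support item SmirnovCardyTri so that the deciding theorem needs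
no extra import). No Yang–Baxter bijection is
needed because T_L(u)T_L(u′) = T_L(u′)T_L(u) holds entrywise with nonnegative face weights on [π/3,
2π/3] (block resampling; the positive
carrier does NOT exist — the π/6 exchange face has w₂ = −1, refuter note on stmt-5912), and the
linear map is pinned with NO drift computation
by the tree's Beffara machinery
(Literature.Barriers.CriticalPhenomena.EmbeddingModulusUniqueness_holds,
BeffaraShearDistortsModulus_holds):
a quarter-turn-invariant family linearly conjugate to a conformally invariant one is conjugate by a
similarity. The IK-specific statements are
typed over the explicit i.i.d.-bit gauge of the isotropic IK point introduced by the sibling route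
CardyDiluteOrbit (stmt-5911–5917; read back
symbol by symbol by two refuter reviews: every box marginal is the free corner-fugacity field with t
= √3/2, translation-covariant,
D₄-symmetric, S = ∅ member = site-𝕋), so the two routes now share IKMixedBoxCrossing (stmt-5911) and
this route's X₁-conclusion is literally
CardyDiluteOrbit's CardyIK (stmt-5913): alternative decompositions of one target, pooled provers.
Imported areas: Yang–Baxter integrability
used only as commutation (exactly solvable models), coupling/transport technology of
GrimmettManolescu2014 and DKKMO2020Rotational
(arXiv:2012.11672), plane conformal geometry (moduli under linear maps). What no prior route does:
CardyIsoradial transports inside the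
bond-isoradial class 𝒢 and needs an anchor where Cardy is OPEN; CardyRotToConf/CardyUniqueLimit need
scale invariance of bond-ℤ² itself;
CardyDiluteOrbit reaches CardyIK by an exact boundary-law identity plus a bulk step; here the anchor
is Smirnov's theorem, the bulk step is
Manolescu's transport, and the output is a D₄-symmetric ℤ² cell model with PROVED Cardy, leaving a
same-lattice, same-symmetry universality
step (r3) as the residual. Negatives index (5 refuted statements, 2026-08-15; in this sub only
stmt-6949, the dual-current template): unrelated.

RANKED CRUXES. Three cruxes after the g5 re-badge (2026-08-15): r2 IKLinearTransport, r3
CornerLineDescent, r4 IKMixedBoxCrossing; all typed; P_IK denotes the explicit isotropic-IK crossing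
family (let-bound verbatim in r2, r3 and IKQuarterTurn).
#2 IKLinearTransport (crux, hardest, line-defining) — Manolescu Thm 5.4 for the A₂⁽²⁾ family at λ =
π/3: ∃ invertible real-linear K with
P_IK R δ → L iff triDomainCrossingProb (R.map K) δ → L, every conformal rectangle R, every L;
mechanism: slide u = π/3 (brick-wall site-𝕋)
double rows through u = π/2 rows by two-row block-resampling exchanges, then §5.3 of
arXiv:2502.08394 (nails, IIC increments, LLN for the
drift) on a large torus/cylinder. (why it might fail: the two-row exchange is a NON-LOCAL
conditional resampling (no positive carrier: the π/6 Yang–Baxter face has w₂ = −1), so nail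
increments come jointly and Manolescu §5.3's LLN/IIC inputs (FKG, quasi-multiplicativity) are
missing; RSW must be uniform over mixed rows; brick-wall-𝕋 vs G02 recipes.) [arXiv:2502.08394 Thm
5.4 §5.3 Rem 5.6, arXiv:2012.11672 Thm 1.9,
arXiv:1108.2784, arXiv:1204.0505, arXiv:2211.12379 §2.2/§3.6, GlazmanManolescu2019,
stmt-CriticalPhenomena-5912]
#3 CornerLineDescent (crux; stmt-10964) — Cardy for P_IK in every conformal rectangle ⇒ Cardy for
the crude bond-ℤ² event at p = ½ on the
STANDARD embedding in every conformal rectangle (the consequent is verbatim the antecedent of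
CrudeToCanonical); mechanism: CornerIrrelevance
along the exactly self-dual D₄ line b = ½ of the corner-fugacity plane M(t,½), t from √3/2 to 0, +
FreezeIdentification M(0,½) = bond-ℤ² on the
renewal grid in the slack-free cell picture (XOR colourings, i.i.d. geometric gaps, fair coins) +
homogenisation of the renewal grid; typed at the
standard embedding because embDomainCrossing's fixed 2δ endpoint slack is a.s. empty infinitely
often as δ → 0⁺ on sparse product grids (hazard
note on stmt-5077, retriage seat) — the product-grid existential form first filed was not false
(regular grids witness it) but artefact-laden;
the same-embedding o(1) form is CardyDiluteOrbit's IKBondBridge (stmt-5914). (why it might fail: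
one-lattice universality of conjunct calibre: the corner marginal is a 4-body plaquette field, no
FKG/RSW for 0 < t < 1 (Cov = −ρ/16 on a face), a defect is a macroscopic XOR rewiring, t → 0⁺ (scale
1/t, sparse renewal grid) is singular; a Russo attack meets the CoveringLatticeShift 3/4-rate wall.)
[arXiv:0708.3908 §5,
arXiv:1008.1378 §2, Nienhuis1990, arXiv:2012.11672, stmt-CriticalPhenomena-5914,
route-CriticalPhenomena-CardyCornerFugacity]
#4 IKMixedBoxCrossing (crux; = stmt-CriticalPhenomena-5911 of CardyDiluteOrbit, attached; replaces
the informal IKBoxCrossing) — RSW for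
the mixed family uniformly over the set S of isotropic columns among honeycomb (site-𝕋) ones, both
box shapes; the row-mixed family of r2
is its image under the diagonal reflection (v0,v1) ↦ (v1,v0). (why it might fail: no FKG: the colour
marginal ∝ t^(#odd plaquettes) is a ferromagnetic 4-body field failing the Holley condition, so
KST/GM RSW transport and Köhler-Schindler–Tassion renormalisation have no positive association to
lean on; uniformity over all patterns S adds anisotropy and degenerate u → π/3 rows.)
[arXiv:2011.04618,
arXiv:1105.5535, arXiv:1204.0505, GlazmanManolescu2019, arXiv:2211.12379,
stmt-CriticalPhenomena-5911]

SUPPORT. #6 CrudeToCanonical (stmt-4968, DEMOTED crux → support by the g5 re-badge) — on ℤ², Cardy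
for the crude embedded crossing event in EVERY conformal rectangle implies Cardy for G02's
bondDomainCrossingProb in every conformal rectangle (global form of stmt-CriticalPhenomena-0787);
still a hypothesis of `closes`. Its recorded hazard (largest-component Ω_δ = bulk only when
volume(∂Ω) = 0; an Osgood boundary comb could outnumber the bulk) is REMOVED in the tree:
Literature.Probability.RandomPlanarGeometry.JordanDomain.exists_forall_mem_meshDomain_and_reachable
(LatticeModels/MeshDomainJordan.lean: for EVERY Jordan domain the largest mesh component is the bulk
and is connected, positive-area boundaries included) and
Literature.Probability.Percolation.discreteCrossingProb_clusterPt_mem_Ioo_holds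
(Percolation/BoxCrossingJordan.lean: RSW chaining near the accessible arcs + FKG + duality for
bond-ℤ² in every conformal rectangle). What remains is the Bollobás–Riordan Ch. 7 sandwich comparing
the 2δ-slack crude event with G02's distance-comparison arcs using exactly those tools:
discretisation glue, difficulty M (grounder batch g19: 'discretisation-glue'). [tree decls above,
BollobasRiordan2006 Ch. 7, CamiaNewman2006, stmt-CriticalPhenomena-0787] #4' IKBoxCrossing
(stmt-5078, informal-only, DEMOTED crux → support: duplicate of the typed crux IKMixedBoxCrossing
stmt-5911, same no-FKG RSW obstruction for exactly the two-valued row mixtures r2 uses; to be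
DROPPED as soon as the assembly count permits an edit). #5 RenewalGridHarmless (stmt-4967, DEMOTED
crux → support: no longer a hypothesis of `closes`; its antecedent — crude Cardy on a
product grid — is a.s. never met by unbounded-gap grids because of the 2δ slack (hazard note on
stmt-5077), so its live content is the
bounded-gap / slack-rescaling case (why it might fail kept: equicontinuity over all Jordan
rectangles, non-scale-covariant slack); kept as the
optional product-grid variant of the descent's last step; boundary RSW arm control for bond-ℤ² in
every conformal rectangle is now in tree, BoxCrossingBounds/BoxCrossingJordan). #9 IKQuarterTurn —
hypothesis (a) of AnchorByRigidity for P := P_IK: P_IK (i·R) and P_IK R have the same δ → 0⁺ limits;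
intended proof = the finite-δ identity from the measure-preserving bit bijection (A'_m = A_0 ⊕ B_0 ⊕
B_(−m), B'_n = A_0 ⊕ B_0 ⊕ A_n,
plaquettes permuted, coins permuted-and-flipped) realising the lattice rotation ρ(v) = (−v1, v0),
z(ρv) = i z(v), plus isometry
covariance of embDomainCrossing (carrier_map, arc_map, infDist); no new mathematics [difficulty M].
#9 SmirnovCardyTri —
hasCrossingLimit_triDomainCrossingProb, provable in one line by
hasCrossingLimit_triDomainCrossingProb_holds (needs-fact item, D-0027
glue.extra-hypothesis pattern of CardyHarmonicInvariants). #9 AnchorByRigidity (unchanged) — Smirnov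
⇒ ∀ P K, (a) → (b) → K is a
similarity ∧ Cardy for P; provable now from SimilarityRigidity, strictMonoOn_cardyFunction_holds,
exists_isUniformizing_holds,
crossRatio_eq_of_isUniformizing_holds (E = K ∘ (i·) ∘ K⁻¹ preserves all moduli ⇒ similarity; E⁴ =
id, E² = −id ⇒ E = ±i· ⇒ K complex-
or conjugate-linear ⇒ ‖Kz‖ = c‖z‖; a conformal or anticonformal similarity preserves cross-ratios,
crossRatio_neg for the anti case).
#9 SimilarityRigidity (unchanged) — a real-linear automorphism preserving every conformal modulus is
a similarity (Beffara shear +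
BeffaraShearDistortsModulus_holds). DECIDING THEOREM `closes : IKLinearTransport → CornerLineDescent
→ CrudeToCanonical → IKQuarterTurn → SmirnovCardyTri → AnchorByRigidity →
_root_.CardyFormulaZ2` — certified by this seat (Sketch.lean rc 0, sorry-free, axioms
propext/Classical.choice/Quot.sound; gate native preview
h21_check_closes ok): obtain K; `specialize (AnchorByRigidity Smirnov) _ K ?qt hK` unifies P := P_IK
from the conjugacy clause, `exact IKQuarterTurn`
closes ?qt by δζβ-conversion; CornerLineDescent then CrudeToCanonical, `exact` against the unfolded
abbrev. Bookkeeping (verified again by the g5 re-badge seat: `--drop Assembly2` bounces 'the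
assembly item cannot be dropped', retriage refuses assembly items, restate keeps the kind, and every
other structural edit bounces on route.multi-assembly): Assembly (stmt-4971) keeps the opening
seat's abstract-P frame (typed, true, provable by logic); Assembly2 (stmt-5077, the informal
CornerLineDescent text mis-registered as kind assembly at open) carries the typed chain of `closes`
and is provable by `exact closes`; an OPERATOR `route edit --drop Assembly2` clears
route.multi-assembly (needs-human note filed on stmt-5077), after which IKBoxCrossing is dropped and
Assembly may be restated as the rank-ordered chain SmirnovCardyTri → IKLinearTransport →
IKQuarterTurn → AnchorByRigidity → CornerLineDescent → CrudeToCanonical → CardyFormulaZ2 (checked rc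
0 against `closes`).

TWO-LAYER PLAN. Foreseen glued splits (nothing filed now): IKLinearTransport ⇐ BlockExchange
(existence of the two-row conditional-resampling
coupling for u,u′ ∈ [π/3, 2π/3] on the explicit gauge, outside colours preserved, vertical
displacement ≤ 2; needs the identification
'explicit gauge box marginal = free plaquette field = A₂⁽²⁾ face-transfer formulation',
refuter-verified on paper) → RowMixing (LLN /
decorrelation along the row for the exchanged block given boundary link patterns) →
IKLinearTransport (Manolescu §5.3 re-run).
CornerLineDescent ⇐ FreezeIdentification (M(0,½) = bond-ℤ² on the renewal grid, provable) →
CornerIrrelevance (limits constant along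
b = ½, t ∈ (0, √3/2]) → CornerLineDescent. AnchorByRigidity ⇐ SimilarityRigidity → (limit
bookkeeping) → AnchorByRigidity (k ≤ 3 each). CornerLineDescent's last step may alternatively
route through RenewalGridHarmless (product-grid homogenisation with a slack-rescaled event).

KILL CRITERIA. (i) A transfer-matrix / Monte-Carlo measurement of P_IK crossing probabilities of 2:1
rectangles or of the four-point crossing of a
disc converging AWAY from Cardy's values (beyond finite-size drift) refutes X₁ and closes the route
(`refuted:IKLinearTransport`); it
would also falsify the honeycomb dictionary or percolation-class universality of the dense A₂⁽²⁾
point, a notable fact either way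
(and would refute CardyDiluteOrbit's CardyIK with it). (ii) A proof that adjacent u ≠ u′ rows admit
NO coupling with bounded displacement
preserving outside colours kills the block-exchange mechanism of r2 → pivot to the half-strip
statement of card ik-honeycomb-perron-teleport
/ CardyDiluteOrbit's BoundaryLawInvariance (no coupling needed). (iii) ¬CornerLineDescent (e.g.
M(t,½) off the percolation class for small t)
severs the summit link only: close `refuted:CornerLineDescent`, keep X₁ as a Literature-grade target
and re-open the descent as an
IK ↔ bond-ℤ² linear-conjugacy route (AnchorByRigidity closes that too, both ends being
D₄-symmetric). (iv) ¬IKQuarterTurn would mean the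
explicit gauge is mis-transcribed (it is an exact symmetry on paper): repair the statement, not the
line. (v) ¬CrudeToCanonical signals a mis-specified discretisation (report to operator; route
blocked, not the conjunct); ¬RenewalGridHarmless
(support) only removes the product-grid variant. CardyFormulaZ2 proved elsewhere moots r3, r6 but
not X₁.

NOT DECOMPOSED YET. The interior of r2 (nails / IIC increments / speed for rows of different width
structure; torus vs Sklyanin double-row open strips;
the rate δ^c; the identification of the explicit gauge with the face-transfer-matrix formulation),
the RSW constants' uniformity as u → π/3
(inside r4), the whole interior of r3 (owned jointly with card corner-fugacity-plane and
CardyDiluteOrbit's IKBondBridge), CLE₆ / loop-ensemble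
forms of X₁ (Camia–Newman topology, tree exists_isCNLFamily_tendsto) — crossing form only —,
boundary/discretisation matching between the
brick-wall site-𝕋 event and G02's triCrossing (absorbed into r2's statement), and every constant.

CHEAPEST FALSIFIER. Two finite checks and one computation. (1) The dictionary: at λ = π/3 the A₂⁽²⁾
face weights at u = π/3 are (eight tiles 1, ninth 0) =
site-𝕋 with a fixed diagonal, and at u = π/2 they are (1, 1, √3/2, ½, ½) with all nine weights ≥ 0
on [π/3, 2π/3] — checked by hand
from the Warnaar–Nienhuis–Seaton weights (ρ₁ = sin²u, ρ₂..₅ = (√3/2) sin u, ρ₆,₇ = sin²u, ρ₈ = sin u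
sin(2π/3−u), ρ₉ = sin u sin(u−π/3))
and printed in arXiv:2211.12379 §3.6; the explicit gauge's dictionary (p = t/(1+t) = 2√3−3 ⇔ t =
√3/2; S = ∅ ⇒ site-𝕋) was re-derived by
two refuter reviews (notes on stmt-5911). (2) kit compute: exact transfer matrices (width ≤ 8) or
heat-bath MC (L = 64–256) of P_IK: square
crossing must be ½ exactly (self-duality) and the 2:1-rectangle / disc four-point crossings must
approach Cardy's values; a clear mismatch
kills X₁ — RUN by refuter route-review gen-3 (evidence ADDENDUM-g3-CardyIKTransport.md on
stmt-CriticalPhenomena-5076, exact sampling of this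
very gauge, free boundary): 2:1 boxes 0.1776 ± 0.0023 pooled (L = 128…512) vs Cardy 0.175647, 3:1
boxes 0.0600 ± 0.0031 vs 0.061638, square
0.4975 ± 0.011 (= ½ by duality), bond-ℤ² in the same boxes showing the same finite-size pattern, and
the corner line b = ½ at t = 1, 0.4, 0.25 within
1.5σ of Cardy (bears on CornerLineDescent): NOT KILLED; sharper run = kit job j001448 (queued, lands
on stmt-5076). (3) For r2's mechanism: implement
the two-row block coupling exactly for L ≤ 10 and measure the displacement law of a tagged strand.
Not run here (route-repair seat).

NUMBERS. IK(π/2) vertex weights (vacancy, straight, turn, NE-pairing, NW-pairing) = (1, 1, √3/2, ½,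
½); IK(π/3): eight tiles 1, ninth 0
(arXiv:2211.12379 §3.6). Explicit gauge: plaquette defect probability p = 2√3 − 3 ≈ 0.4641, t =
p/(1−p) = √3/2; saddle coins fair (b(π/2) = ½);
at u = π/3: p = ½ (t = 1), coin forced (b = 1). Corner-fugacity coordinates of the IK curve: t =
√3/(2 sin u), b = sin(2π/3 − u)/sin u, the
hyperbola t² − (b − ½)² = ¾ through (1,1), (√3/2, ½), (1,0); bond-ℤ² = (0, ½) (renewal grid, mean
spacing 2, a = 2). Manolescu's rate:
d_CN ≤ C δ^c (Thm 5.4). Exchange face at π/6: t = √3, w₁ = 2, w₂ = −1 (signed). Items after the g5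
re-badge (rev 4): cruxes r2 IKLinearTransport (5076), r3 CornerLineDescent (10964), r4
IKMixedBoxCrossing (5911) = 3; supports CrudeToCanonical (4968, demoted, hypothesis of closes),
RenewalGridHarmless (4967), IKQuarterTurn (10900), SmirnovCardyTri (6432), AnchorByRigidity (4969),
SimilarityRigidity (4970), IKBoxCrossing (5078, informal duplicate, demoted, to drop); assembly-kind
Assembly (4971, old frame) + Assembly2 (5077, typed chain = closes; operator drop requested);
deciding theorem `closes` with 6 hypotheses.

DEFINITION REQUESTS. D1–D2 of the opening seat HAVE LANDED:
Literature/Probability/LatticeModels/CornerFugacityMeasure.lean (cornerFugacityMeasure t b Λ ξ,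
ikMeasure u, freeIKMeasure, ikCrossingProb u R δ = FREE finite-volume measure in cellBox R δ with
the G02 cell event cellDomainCrossing; ikCrossingProb_pi_div_two_rot / _reflect = exact D₄
covariance at u = π/2; ikCrossingProb_pi_div_three = the site-𝕋 member). The typed items of this
route use instead the inline infinite-volume i.i.d.-bit gauge P_IK with the crude event
embDomainCrossing (shared verbatim with CardyDiluteOrbit, stmt-5911/5913/5914, pooled provers). The
two typings agree on box marginals (free plaquette field, t = √3/2) but differ by volume/boundary
convention AND by crossing event, so their δ → 0⁺ limit-equivalence is an RSW-type lemma, not rfl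
(grounder g19-13 flag). TENURE DECISION (not taken by the re-badge seat; any item add is blocked
until the assembly count is 1): either keep the inline gauge (IKQuarterTurn then needs the
bit-bijection proof sketched above) or add the support bridge `∀ R L, Tendsto (P_IK R) (𝓝[>] 0) (𝓝
L) ↔ Tendsto (ikCrossingProb (π/2) R) (𝓝[>] 0) (𝓝 L)`, after which IKQuarterTurn follows from
ikCrossingProb_pi_div_two_rot. D3 (cite fact, crit-ising): "site percolation on 𝕋 = dilute A₂⁽²⁾
loop model at λ = u = π/3; isotropic point u = π/2; face weights nonnegative on [π/3, 2π/3]"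
(MorinduchesneKlumperPearce2023 §2.2/§3.6; Warnaar–Nienhuis–Seaton 1992) is realised in that file's
docstring and lemmas (coe_ikCornerFugacity_pi_div_two, ikMeasure_pi_div_three).

Novelty: Searches (2026-08-15): `lit search` local ×4 (searchd down: connection reset), `--source
arxiv|openalex|s2` (HTTP 429 ×3),
`--source zbmath "dilute loop model square lattice percolation Yang-Baxter universality"` (1 hit:
arXiv:2211.12379, READ §2.2, §3.6, §8),
`lit vsearch "universality up to linear deformation for the dilute O(1)/Izergin-Korepin loop model
…"` (8 book hits, none relevant),
`lit galaxy search "Izergin-Korepin percolation" --star all` (queued > 90 s, unavailable), `lit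
frontier CriticalPhenomena --since 2020`
(30 rows, none on dilute/IK transport), `lit bridges CriticalPhenomena --cross any` (none relevant),
`lit read arxiv:2502.08394` (Thm 5.4
p. 73, p. 74, Rem 5.6 pp. 74–75, §5.4.2 p. 155 read), tree reads (EmbeddingModulusUniqueness +
Proofs, CardyFormula, ChordalCurveFamily,
CLE6/CLE6Limit, NienhuisWeightsExcludeVertexSAW, six sibling Theses), plus the card's
refuter-audited searches of 2026-08-15.
Nearest prior art found: arXiv:2502.08394 (Manolescu 2025) Thm 5.4 + §5.4.2 and arXiv:2012.11672
(DKKMO) Thm 1.9 — the engine and the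
symmetry interplay, for the isoradial six-vertex/FK family only, on LOCAL star–triangle kernels with
FKG; arXiv:2211.12379
(Morin-Duchesne–Klümper–Pearce 2023) — site-T percolation AS the dilute A₂⁽²⁾ model at λ = π/3 with
commuting single/double-row transfer
matrices and Bethe-ansatz CFT data ("compelling evidence" of bond-ℤ²/site-T universality, no
coupling, no theorem); Beffara2008Universal
Prop. 4 (rigidity; in tree, proved);  [refs: 2211.12379, 2502.08394, 2012.11672, 1411.7020, arxiv:2502.08394]

Barriers (technique_class: block-resampling transport up-to-linear-map rigidity): - technique_class: block-resampling transport up-to-linear-map rigidity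
- Literature.Barriers.CriticalPhenomena.EmbeddingModulusUniqueness: EVADED exactly as its audited
block licenses ("NOT blocked: the shear-invariant ∃M form … a route split as (blind ∃M step) +
(symmetry step) meets this barrier only in its second, elementary step"): r2 is the blind ∃K step
(it would output a sheared limit for a sheared IK model, as the barrier predicts), AnchorByRigidity
is the symmetry step using evasion (i) — the exact order-4 rotation of IK(π/2) ⊂ δℤ² — and the
barrier's own theorem (EmbeddingModulusUniqueness_holds) is an INPUT of SimilarityRigidity.
- Literature.Barriers.CriticalPhenomena.SmirnovTriangularOnly: not met — no colour switching /
harmonic triple is transplanted; Smirnov's theorem enters only on T, as the hypothesis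
hasCrossingLimit_triDomainCrossingProb.
- Literature.Barriers.CriticalPhenomena.CoveringLatticeShift: not met by X₁ (no Russo interpolation,
no shift pairing: transport is by measure-preserving block exchanges at fixed weights); r3 (descent
along b = ½) is an interpolation on ONE translation-invariant, exactly self-dual family, so the
specific shift q ↦ 1−q does not arise, but the barrier's generic residue (a > 3/4-type rate for the
sub-leading pivotal term) is inherited if r3 is attacked by Russo's formula — the bet is that r3 is
instead closed by a second transport + the same rigidity (both ends D₄).
- Literature.Barriers.CriticalPhenomena.FKParafermionicHal

Novelty grade: new-combination — ROUTE REVIEW+novelty (refuter 2026-08-15). new-combination = Manolescu2025 (2502.08394 Thm 5.4, Rem 5.6 asks to exit the isoradial class) + Morin-Duchesne-Klumper-Pearce 2023 (2211.12379: site-T = n=1 dilute A2(2) at lambda=pi/3, commuting in u) + Beffara2008 Prop 4 / tree EmbeddingModulusUniqueness (refuter refuter-rreview-route-MatrixMultiplicati-88df8b29-0, 2026-08-15T13:43:42Z; prior: arXiv:2502.08394,arXiv:2211.12379,arXiv:0708.3908,arXiv:1204.0505,arXiv:2012.11672,route-CriticalPhenomena-CardyCornerFugacity,stmt-CriticalP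henomena-0787)

History (route lifecycle, newest last):
- 2026-08-16T14:15:59Z · LINT AUTOFIX: dropped duplicate assembly item(s) Assembly2 (kept the one `closes` uses) (operator:gate4)
- 2026-08-26T07:51:30Z · DORMANT — reconciler: no traction for 8.4 d (last activity item-evidence-added at 2026-08-17T21:54:40Z); parked, not closed — `ledger route dormant route-CriticalPhenomen (operator:999:2248352)

sub-problem: CardyFormulaZ2 · status: dormant · opened planner-plancard-CriticalPhenomena-CardyFormu-a8c680b7-0 2026-08-15T11:38:40Z · rev 6 · ledger route-CriticalPhenomena-CardyIKTransport
GENERATED by the gate from the ledger (D-0016/17). Provers cite these decls: `theorem foo : Summit.CriticalPhenomena.CardyFormulaZ2.Theses.CardyIKTransport.<Decl> := …` in Summits/CriticalPhenomena/CardyFormulaZ2/Theorems/<Name>.lean.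
-/

namespace Summit.CriticalPhenomena.CardyFormulaZ2.Theses.CardyIKTransport

open scoped BigOperators Topology Manifold Classical MeasureTheory ProbabilityTheory Matrix InnerProductSpace ComplexConjugate ContinuousMap
open Filter Set Function TopologicalSpace MeasureTheory

attribute [summit_statement] _root_.CardyFormulaZ2

/-- item stmt-CriticalPhenomena-5076 · crux · rank 2 · open · by planner
why it might fail: two-row exchange is a NON-LOCAL conditional resampling (no positive carrier: the pi/6 Yang-Baxter face has w2 = -1), so nail increments come jointly and the LLN/IIC inputs of 2502.08394 sec 5.3 (FKG, quasi-multiplicativity) are missing; RSW must be uniform over mixed rows; brick-wall-T vs G02 event.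
sources: Manolescu2025ExploringFK, arXiv:2502.08394, DKKMO2020Rotational, arXiv:2012.11672, arXiv:1108.2784, GrimmettManolescu2014
[crux] IKLinearTransport (rank 2, hardest, line-defining; card ik-isotropic-cle6-transport B2.3).
Manolescu's "universality up to linear deformation" (arXiv:2502.08394 Thm 5.4) for the n = 1 dilute
A_2^(2) (Izergin–Korepin) commuting family at λ = π/3, u ∈ [π/3, π/2]: there is an invertible
real-linear K : ℂ → ℂ such that, for every conformal rectangle R, the crossing probabilities of the
isotropic model IK(π/2) on δℤ² (cell-colouring field of the cell grid with corner fugacity √3/2 and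
fair saddle coins; definitions D1–D2) in R and the site-T crossing probabilities
triDomainCrossingProb (R.map K) have the same δ → 0⁺ limits. INTENDED SIGNATURE once D2 lands (=
hypothesis (b) of Assembly / AnchorByRigidity with P := ikCrossingProb (π/2)): ∃ K : ℂ ≃L[ℝ] ℂ, ∀ (R
: ConformalRectangle) (L : ℝ), Tendsto (ikCrossingProb (π/2) R) (𝓝[>] 0) (𝓝 L) ↔ Tendsto
(triDomainCrossingProb (R.map K.toHomeomorph)) (𝓝[>] 0) (𝓝 L). MECHANISM: the u = π/3 member is site
percolation on T drawn with one fixed diagonal (eight tiles of weight 1, ninth 0: arXiv:2211.12379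
§2.2/§3.6); slide u = π/3 double rows down through u = π/2 rows by two-row BLOCK-RESAMPLING
exchanges (T_L(u)T_L(u′) = T_L(u′)T_L(u) entrywi -/
@[route_item "route-CriticalPhenomena-CardyIKTransport", crux]
def IKLinearTransport : Prop :=
  let P : Literature.Probability.RandomPlanarGeometry.ConformalRectangle → ℝ → ℝ := (fun R => let μ := (Literature.Probability.Percolation.sitePercolation ℤ Literature.Probability.Percolation.half).prod ((Literature.Probability.Percolation.sitePercolation ℤ Literature.Probability.Percolation.half).prod ((Literature.Probability.Percolation.sitePercolation (Literature.Probability.LatticeModels.Site 2) (Set.projIcc (0:ℝ) 1 zero_le_one (2 * Real.sqrt 3 - 3))).prod ((Literature.Probability.Percolation.sitePercolation (Literature.Probability.LatticeModels.Site 2) Literature.Probability.Percolation.half).prod (Literature.Probability.Percolation.sitePercolation (Literature.Probability.LatticeModels.Site 2) Literature.Probability.Percolation.half)))); let par : (Set ℤ × (Set ℤ × (Set (Literature.Probability.LatticeModels.Site 2) × (Set (Literature.Probability.LatticeModels.Site 2) × Set (Literature.Probability.LatticeModels.Site 2))))) → Literature.Probability.LatticeModels.Site 2 → Prop := fun ω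 f => (f 0 ∈ (Set.univ : Set ℤ) ∧ f ∈ ω.2.2.1) ∨ (f 0 ∉ (Set.univ : Set ℤ) ∧ f ∈ ω.2.2.2.1); let blk : (Set ℤ × (Set ℤ × (Set (Literature.Probability.LatticeModels.Site 2) × (Set (Literature.Probability.LatticeModels.Site 2) × Set (Literature.Probability.LatticeModels.Site 2))))) → Literature.Probability.LatticeModels.Site 2 → Prop := fun ω v => Xor (v 0 ∈ ω.1) (Xor (v 1 ∈ ω.2.1) (Odd ((Finset.filter (fun f : ℤ × ℤ => par ω ![f.1, f.2]) (Finset.Ico (min 0 (v 0)) (max 0 (v 0)) ×ˢ Finset.Ico (min 0 (v 1)) (max 0 (v 1)))).card))); let anti : (Set ℤ × (Set ℤ × (Set (Literature.Probability.LatticeModels.Site 2) × (Set (Literature.Probability.LatticeModels.Site 2) × Set (Literature.Probability.LatticeModels.Site 2))))) → Literature.Probability.LatticeModels.Site 2 → Prop := fun ω f => f 0 ∉ (Set.univ : Set ℤ) ∨ f ∈ ω.2.2.2.2; let edges : (Set ℤ × (Set ℤ × (Set (Literature.Probability.LatticeModels.Site 2) × (Set (Literature.Probability.LatticeModels.Site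 2) × Set (Literature.Probability.LatticeModels.Site 2))))) → Literature.Probability.Percolation.BondConfig (Literature.Probability.LatticeModels.Site 2) := fun ω => {e | ∃ u v, e = s(u, v) ∧ blk ω u ∧ blk ω v ∧ (v = u + ![1, 0] ∨ v = u + ![0, 1] ∨ (v = u + ![1, 1] ∧ ¬ anti ω u) ∨ (v = u + ![1, -1] ∧ anti ω (u + ![0, -1])))}; fun δ : ℝ => μ.real {ω | edges ω ∈ Literature.Probability.Percolation.embDomainCrossing (fun v : Literature.Probability.LatticeModels.Site 2 => ((v 0 : ℝ) : ℂ) + ((v 1 : ℝ) : ℂ) * Complex.I) R.carrier δ (R.arc 0) (R.arc 2)}); ∃ K : ℂ ≃L[ℝ] ℂ, ∀ (R : Literature.Probability.RandomPlanarGeometry.ConformalRectangle) (L : ℝ), Filter.Tendsto (P R) (nhdsWithin 0 (Set.Ioi 0)) (nhds L) ↔ Filter.Tendsto (Literature.Probability.Percolation.triDomainCrossingProb (R.map K.toHomeomorph)) (nhdsWithin 0 (Set.Ioi 0)) (nhds L)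

/-- item stmt-CriticalPhenomena-10964 · crux · rank 3 · open · by planner
why it might fail: one-lattice universality of conjunct calibre: the corner marginal is a 4-body plaquette field with no FKG/RSW for 0 < t < 1, each defect is a macroscopic XOR rewiring, t -> 0+ (freezing onto the renewal grid, scale 1/t) is singular; a Russo attack inherits the CoveringLatticeShift >3/4-rate residue.
sources: Beffara2008Universal, arXiv:0708.3908, arXiv:1008.1378, Nienhuis1990, DKKMO2020Rotational, arXiv:2012.11672
[crux] CornerLineDescent (rank 3; the card's descent step, shared in content with card
corner-fugacity-plane F2+F4 and with CardyDiluteOrbit's IKBondBridge stmt-5914, which is the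
same-embedding o(1) form). Cardy for P_IK (the explicit isotropic IK gauge; the antecedent is
CardyDiluteOrbit's CardyIK, stmt-5913, up to `exact`) in every conformal rectangle ⇒ Cardy for
bond-ℤ² at p = ½, crude embedded event embDomainCrossing, on SOME asymptotically homogeneous
isotropic product grid {s_i} × {t_j} (StrictMono, s_i/i → a and t_j/j → a two-sidedly, same a > 0).
Mechanism: CornerIrrelevance along the exactly self-dual D₄ line b = ½ of the corner-fugacity plane
M(t, ½), t from √3/2 down to 0, + FreezeIdentification M(0, ½) = bond-ℤ² on the renewal grid (XOR
colourings, i.i.d. geometric gaps of mean 2, fair coins) + Fubini/SLLN (a = 2); both ends are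
D₄-symmetric, so a transport up to a linear map along the line is again closed by
AnchorByRigidity-type rigidity. The consequent is verbatim the antecedent of RenewalGridHarmless.
[deps: IKLinearTransport] [difficulty: open-problem] Why it might fail: one-lattice universality of
conjunct calibre: the corner marginal is a 4-body plaquette field -/
@[route_item "route-CriticalPhenomena-CardyIKTransport", crux]
def CornerLineDescent : Prop :=
  let P : Literature.Probability.RandomPlanarGeometry.ConformalRectangle → ℝ → ℝ := (fun R => let μ := (Literature.Probability.Percolation.sitePercolation ℤ Literature.Probability.Percolation.half).prod ((Literature.Probability.Percolation.sitePercolation ℤ Literature.Probability.Percolation.half).prod ((Literature.Probability.Percolation.sitePercolation (Literature.Probability.LatticeModels.Site 2) (Set.projIcc (0:ℝ) 1 zero_le_one (2 * Real.sqrt 3 - 3))).prod ((Literature.Probability.Percolation.sitePercolation (Literature.Probability.LatticeModels.Site 2) Literature.Probability.Percolation.half).prod (Literature.Probability.Percolation.sitePercolation (Literature.Probability.LatticeModels.Site 2) Literature.Probability.Percolation.half)))); let par : (Set ℤ × (Set ℤ × (Set (Literature.Probability.LatticeModels.Site 2) × (Set (Literature.Probability.LatticeModels.Site 2) × Set (Literature.Probability.LatticeModels.Site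 2))))) → Literature.Probability.LatticeModels.Site 2 → Prop := fun ω f => (f 0 ∈ (Set.univ : Set ℤ) ∧ f ∈ ω.2.2.1) ∨ (f 0 ∉ (Set.univ : Set ℤ) ∧ f ∈ ω.2.2.2.1); let blk : (Set ℤ × (Set ℤ × (Set (Literature.Probability.LatticeModels.Site 2) × (Set (Literature.Probability.LatticeModels.Site 2) × Set (Literature.Probability.LatticeModels.Site 2))))) → Literature.Probability.LatticeModels.Site 2 → Prop := fun ω v => Xor (v 0 ∈ ω.1) (Xor (v 1 ∈ ω.2.1) (Odd ((Finset.filter (fun f : ℤ × ℤ => par ω ![f.1, f.2]) (Finset.Ico (min 0 (v 0)) (max 0 (v 0)) ×ˢ Finset.Ico (min 0 (v 1)) (max 0 (v 1)))).card))); let anti : (Set ℤ × (Set ℤ × (Set (Literature.Probability.LatticeModels.Site 2) × (Set (Literature.Probability.LatticeModels.Site 2) × Set (Literature.Probability.LatticeModels.Site 2))))) → Literature.Probability.LatticeModels.Site 2 → Prop := fun ω f => f 0 ∉ (Set.univ : Set ℤ) ∨ f ∈ ω.2.2.2.2; let edges : (Set ℤ × (Set ℤ × (Set (Literature.Probability.LatticeModels.Site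 2) × (Set (Literature.Probability.LatticeModels.Site 2) × Set (Literature.Probability.LatticeModels.Site 2))))) → Literature.Probability.Percolation.BondConfig (Literature.Probability.LatticeModels.Site 2) := fun ω => {e | ∃ u v, e = s(u, v) ∧ blk ω u ∧ blk ω v ∧ (v = u + ![1, 0] ∨ v = u + ![0, 1] ∨ (v = u + ![1, 1] ∧ ¬ anti ω u) ∨ (v = u + ![1, -1] ∧ anti ω (u + ![0, -1])))}; fun δ : ℝ => μ.real {ω | edges ω ∈ Literature.Probability.Percolation.embDomainCrossing (fun v : Literature.Probability.LatticeModels.Site 2 => ((v 0 : ℝ) : ℂ) + ((v 1 : ℝ) : ℂ) * Complex.I) R.carrier δ (R.arc 0) (R.arc 2)}); (∀ R : Literature.Probability.RandomPlanarGeometry.ConformalRectangle, R.HasCrossingLimit (P R) Literature.Probability.RandomPlanarGeometry.cardyFunction) → ∀ R : Literature.Probability.RandomPlanarGeometry.ConformalRectangle, R.HasCrossingLimit (fun δ ↦ (Literature.Probability.Percolation.bondPercolation (Literature.Probability.LatticeModels.zdGraph 2) Literature.Probability.Percolation.half).real (Literature.Probability.Percolation.embDomainCrossing Literature.Probability.LatticeModels.squareLatticeEmbedding.z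 R.carrier δ (R.arc 0) (R.arc 2))) Literature.Probability.RandomPlanarGeometry.cardyFunction

/-- item stmt-CriticalPhenomena-5911 · crux · rank 4 · open · by planner
why it might fail: no FKG: Cov(1[s1 or s2], 1[s3 and s4]) = -rho/16 < 0 on one face (rho = (1-t)/(1+t)), so squares = 1/2 does not glue into rectangles (RSW/KST need positive association); RSW-without-FKG is only perturbative; uniformity over all patterns S adds anisotropy and degenerate u -> pi/3 rows.
sources: KohlerSchindlerTassion2023, arXiv:2011.04618, arXiv:1105.5535, GrimmettManolescu2014, arXiv:1204.0505, GlazmanManolescu2019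
[crux] RSW for the mixed family: there is c > 0 such that for EVERY set S ⊆ ℤ of isotropic (θ = π/2)
columns (the others honeycomb, θ = π/3), every n ≥ 1 and every position, the 2n × n and n × 2n cell
boxes are crossed the long way by a black path with probability ≥ c (model written explicitly from
i.i.d. bits: fair line/row bits, plaquette parities Bernoulli(2√3−3) in S-columns and fair
elsewhere, saddle coins fair in S-columns and anti-diagonal forced elsewhere). Card item 'RSW for
the dilute O(1) model'; the a-priori input of BoundaryLawInvariance, CardyIK and of route
CardyIKTransport's r2/r4. [difficulty: L] -/
@[route_item "route-CriticalPhenomena-CardyIKTransport", crux]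
def IKMixedBoxCrossing : Prop :=
  ∃ c : ℝ, 0 < c ∧ ∀ S : Set ℤ, ∀ n : ℕ, 1 ≤ n → ∀ a b : ℤ, let μ := (Literature.Probability.Percolation.sitePercolation ℤ Literature.Probability.Percolation.half).prod ((Literature.Probability.Percolation.sitePercolation ℤ Literature.Probability.Percolation.half).prod ((Literature.Probability.Percolation.sitePercolation (Literature.Probability.LatticeModels.Site 2) (Set.projIcc (0:ℝ) 1 zero_le_one (2 * Real.sqrt 3 - 3))).prod ((Literature.Probability.Percolation.sitePercolation (Literature.Probability.LatticeModels.Site 2) Literature.Probability.Percolation.half).prod (Literature.Probability.Percolation.sitePercolation (Literature.Probability.LatticeModels.Site 2) Literature.Probability.Percolation.half)))); let par : (Set ℤ × (Set ℤ × (Set (Literature.Probability.LatticeModels.Site 2) × (Set (Literature.Probability.LatticeModels.Site 2) × Set (Literature.Probability.LatticeModels.Site 2))))) → Literature.Probability.LatticeModels.Site 2 → Prop := fun ω f => (f 0 ∈ S ∧ f ∈ ω.2.2.1) ∨ (f 0 ∉ S ∧ f ∈ ω.2.2.2.1); let blk : (Set ℤ × (Set ℤ × (Set (Literature.Probability.LatticeModels.Site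 2) × (Set (Literature.Probability.LatticeModels.Site 2) × Set (Literature.Probability.LatticeModels.Site 2))))) → Literature.Probability.LatticeModels.Site 2 → Prop := fun ω v => Xor (v 0 ∈ ω.1) (Xor (v 1 ∈ ω.2.1) (Odd ((Finset.filter (fun f : ℤ × ℤ => par ω ![f.1, f.2]) (Finset.Ico (min 0 (v 0)) (max 0 (v 0)) ×ˢ Finset.Ico (min 0 (v 1)) (max 0 (v 1)))).card))); let anti : (Set ℤ × (Set ℤ × (Set (Literature.Probability.LatticeModels.Site 2) × (Set (Literature.Probability.LatticeModels.Site 2) × Set (Literature.Probability.LatticeModels.Site 2))))) → Literature.Probability.LatticeModels.Site 2 → Prop := fun ω f => f 0 ∉ S ∨ f ∈ ω.2.2.2.2; let edges : (Set ℤ × (Set ℤ × (Set (Literature.Probability.LatticeModels.Site 2) × (Set (Literature.Probability.LatticeModels.Site 2) × Set (Literature.Probability.LatticeModels.Site 2))))) → Literature.Probability.Percolation.BondConfig (Literature.Probability.LatticeModels.Site 2) := fun ω => {e | ∃ u v, e = s(u, v) ∧ blk ω u ∧ blk ω v ∧ (v = u + ![1, 0] ∨ v = u + ![0, 1] ∨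 (v = u + ![1, 1] ∧ ¬ anti ω u) ∨ (v = u + ![1, -1] ∧ anti ω (u + ![0, -1])))}; c ≤ μ.real {ω | edges ω ∈ Literature.Probability.Percolation.openCrossing {v | a ≤ v 0 ∧ v 0 < a + 2 * n ∧ b ≤ v 1 ∧ v 1 < b + n} {v | v 0 = a ∧ b ≤ v 1 ∧ v 1 < b + n} {v | v 0 = a + 2 * n - 1 ∧ b ≤ v 1 ∧ v 1 < b + n}} ∧ c ≤ μ.real {ω | edges ω ∈ Literature.Probability.Percolation.openCrossing {v | a ≤ v 0 ∧ v 0 < a + n ∧ b ≤ v 1 ∧ v 1 < b + 2 * n} {v | v 1 = b ∧ a ≤ v 0 ∧ v 0 < a + n} {v | v 1 = b + 2 * n - 1 ∧ a ≤ v 0 ∧ v 0 < a + n}}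

-- item stmt-CriticalPhenomena-5078 · support · rank 4 · open · by planner — informal only, no Lean statement yet:
--   [crux] IKBoxCrossing (rank 4; card ik-isotropic-cle6-transport B2.2, flagged a crux by the novelty
--   audit). Box-crossing property (RSW) for the IK(u) cell-colouring-plus-coins model uniformly in u ∈
--   [π/3, π/2] — for every ρ > 0 there is c(ρ) > 0 with P_{IK(u)}[black crossing of [0, ρn] × [0, n] the
--   long way] ≥ c(ρ) for all n and all u ∈ [π/3, π/2] — and for the mixed-row configurations (a stack of
--   u = π/3 and u = π/2 rows in any order, on the torus/cylinder) met during the transport of r2.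
--   INTENDED SIGNATURE once D1–D2 land: the analogue of Literature gm_boxCrossing / rsw_half for
--   ikMeasure u,

/-- item stmt-CriticalPhenomena-4967 · support · rank 5 · closed · proved by Summit.CriticalPhenomena.CardyFormulaZ2.Theorems.CardyIKTransport.RenewalGridHarmless.renewalGridHarmless_proof (prover) · by planner
why it might fail: the o(1)-sup-norm product distortion moves (Omega; a,b,c,d) at every mesh, so one needs equicontinuity of crude crossing probabilities over ALL Jordan rectangles (boundary arm control: now partly in tree, BoxCrossingJordan); the 2*delta endpoint slack of embDomainCrossing is not scale-covariant.
sources: BollobasRiordan2006 (Ch. 7 boundary sandwich), doi:10.1007/s00220-006-0086-x (CamiaNewman2006, general Jordan domains), arXiv:1204.0505 (GrimmettManolescu2014 §2.2 embedded crossing events), tree: Literature.Probability.RandomPlanarGeometry.cardyFunction_one_sub, Literature/Analysis/Complex/KernelConvergence.lean, tree:Literature.Probability.Percolation.discreteCrossingProb_clusterPt_mem_Ioo_holds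
[crux] bond percolation on ℤ² at p = ½ drawn on ANY asymptotically homogeneous isotropic product
grid {s_i} × {t_j} (strictly increasing, s_i/i → a and t_j/j → a two-sidedly, same a > 0 in both
directions — the renewal grid of the freezing point M(0,½) is such a grid a.s.) has Cardy limits for
the crude embedded crossing event in every conformal rectangle only if the standard embedding does:
(∀ R, Cardy via z_{s,t}) → (∀ R, Cardy via squareLatticeEmbedding.z). Card item B2.6 /
corner-fugacity-plane F2 (RenewalGridHarmless). [difficulty: M] -/
@[route_item "route-CriticalPhenomena-CardyIKTransport"]
def RenewalGridHarmless : Prop :=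
  ∀ (a : ℝ) (s t : ℤ → ℝ), 0 < a → StrictMono s → StrictMono t → Filter.Tendsto (fun i : ℤ => s i / (i : ℝ)) (Filter.cocompact ℤ) (nhds a) → Filter.Tendsto (fun i : ℤ => t i / (i : ℝ)) (Filter.cocompact ℤ) (nhds a) → (∀ R : Literature.Probability.RandomPlanarGeometry.ConformalRectangle, R.HasCrossingLimit (fun δ ↦ (Literature.Probability.Percolation.bondPercolation (Literature.Probability.LatticeModels.zdGraph 2) Literature.Probability.Percolation.half).real (Literature.Probability.Percolation.embDomainCrossing (fun v : Literature.Probability.LatticeModels.Site 2 ↦ (⟨s (v 0), t (v 1)⟩ : ℂ)) R.carrier δ (R.arc 0) (R.arc 2))) Literature.Probability.RandomPlanarGeometry.cardyFunction) → ∀ R : Literature.Probability.RandomPlanarGeometry.ConformalRectangle, R.HasCrossingLimit (fun δ ↦ (Literature.Probability.Percolation.bondPercolation (Literature.Probability.LatticeModels.zdGraph 2) Literature.Probability.Percolation.half).real (Literature.Probability.Percolation.embDomainCrossing Literature.Probability.LatticeModels.squareLatticeEmbedding.z R.carrier δ (R.arc 0) (R.arc 2))) Literature.Probability.RandomPlan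arGeometry.cardyFunction

-- `RenewalGridHarmless` holds: proved by `Summit.CriticalPhenomena.CardyFormulaZ2.Theorems.CardyIKTransport.RenewalGridHarmless.renewalGridHarmless_proof` (its module imports this route file, so no `_holds` link can be stated here).

/-- item stmt-CriticalPhenomena-4968 · support · rank 6 · closed · proved by Summit.CriticalPhenomena.CardyFormulaZ2.Theorems.crudeToCanonical_proof (prover) · by planner
why it might fail: crude event (2*delta endpoint slack, all vertices in Omega) vs G02 event (meshDomain + distance-comparison arcs) differ only near the four marked points and the boundary; needs RSW arm control near accessible arcs + a BR06 Ch.7 sandwich - all inputs now PROVED in tree for bond-Z2.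
sources: tree:Literature.Probability.RandomPlanarGeometry.JordanDomain.exists_forall_mem_meshDomain_and_reachable, tree:Literature.Probability.Percolation.discreteCrossingProb_clusterPt_mem_Ioo_holds, tree:Literature.Probability.Percolation.forall_mem_meshDomain_of_isCompact, BollobasRiordan2006, CamiaNewman2006, stmt-CriticalPhenomena-0787
[crux] on ℤ², Cardy for the crude embedded crossing event (embDomainCrossing
squareLatticeEmbedding.z: open path with all vertices in Ω, endpoints within 2δ of the arcs) in
EVERY conformal rectangle implies Cardy for G02's bondDomainCrossingProb (largest component Ω_δ,
discrete arcs by distance comparison) in every conformal rectangle. Global (∀R → ∀R) form of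
stmt-CriticalPhenomena-0787 (route CardyIsoradial, per-R); a proof of 0787 closes it. [deps:
RenewalGridHarmless] [difficulty: M] -/
@[route_item "route-CriticalPhenomena-CardyIKTransport", crux]
def CrudeToCanonical : Prop :=
  (∀ R : Literature.Probability.RandomPlanarGeometry.ConformalRectangle, R.HasCrossingLimit (fun δ ↦ (Literature.Probability.Percolation.bondPercolation (Literature.Probability.LatticeModels.zdGraph 2) Literature.Probability.Percolation.half).real (Literature.Probability.Percolation.embDomainCrossing Literature.Probability.LatticeModels.squareLatticeEmbedding.z R.carrier δ (R.arc 0) (R.arc 2))) Literature.Probability.RandomPlanarGeometry.cardyFunction) → ∀ R : Literature.Probability.RandomPlanarGeometry.ConformalRectangle, R.HasCrossingLimit (Literature.Probability.Percolation.bondDomainCrossingProb R) Literature.Probability.RandomPlanarGeometry.cardyFunction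

-- `CrudeToCanonical` holds: proved by `Summit.CriticalPhenomena.CardyFormulaZ2.Theorems.crudeToCanonical_proof` (its module imports this route file, so no `_holds` link can be stated here).

/-- item stmt-CriticalPhenomena-10900 · support · rank 9 · closed · proved by Summit.CriticalPhenomena.CardyFormulaZ2.Theorems.IKQuarterTurn.IKQuarterTurn_proof (prover) · by planner
sources: arXiv:0708.3908, arXiv:2012.11672, stmt-CriticalPhenomena-5911
[support] IKQuarterTurn (typed hypothesis (a) of AnchorByRigidity for P := P_IK): for every
conformal rectangle R and every L, P_IK (i·R) δ → L iff P_IK R δ → L as δ → 0⁺ (R.map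
(Homeomorph.mulLeft₀ I)). Intended proof: the finite-δ identity P_IK (i·R) δ = P_IK R δ — the
lattice rotation ρ(v) = (−v1, v0) satisfies z(ρ v) = i z(v), maps the cross {v0 = 0 ∨ v1 = 0} to
itself and faces to faces (main ↔ anti diagonal), and the law of (colours, diagonals) is the unique
'uniform antiderivative' law (i.i.d. Bernoulli plaquettes, i.i.d. fair cross values, fair coins),
hence ρ-invariant; explicitly the bit map A'_m = A_0 ⊕ B_0 ⊕ B_{−m}, B'_n = A_0 ⊕ B_0 ⊕ A_n (m, n ≠
0), A'_0 = A_0, B'_0 = B_0, plaquettes permuted, coins permuted and flipped is a measure-preserving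
bijection of the five-fold product carrying edges ω to its ρ-image, and embDomainCrossing / infDist
are covariant under the isometry z ↦ i z (arc_map, carrier_map). No new mathematics; Lean work on
product measures. [difficulty: M, provable-now] Sources: arXiv:0708.3908, arXiv:2012.11672,
stmt-CriticalPhenomena-5911. -/
@[route_item "route-CriticalPhenomena-CardyIKTransport", crux]
def IKQuarterTurn : Prop :=
  let P : Literature.Probability.RandomPlanarGeometry.ConformalRectangle → ℝ → ℝ := (fun R => let μ := (Literature.Probability.Percolation.sitePercolation ℤ Literature.Probability.Percolation.half).prod ((Literature.Probability.Percolation.sitePercolation ℤ Literature.Probability.Percolation.half).prod ((Literature.Probability.Percolation.sitePercolation (Literature.Probability.LatticeModels.Site 2) (Set.projIcc (0:ℝ) 1 zero_le_one (2 * Real.sqrt 3 - 3))).prod ((Literature.Probability.Percolation.sitePercolation (Literature.Probability.LatticeModels.Site 2) Literature.Probability.Percolation.half).prod (Literature.Probability.Percolation.sitePercolation (Literature.Probability.LatticeModels.Site 2) Literature.Probability.Percolation.half)))); let par : (Set ℤ × (Set ℤ × (Set (Literature.Probability.LatticeModels.Site 2) × (Set (Literature.Probability.LatticeModels.Site 2)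 × Set (Literature.Probability.LatticeModels.Site 2))))) → Literature.Probability.LatticeModels.Site 2 → Prop := fun ω f => (f 0 ∈ (Set.univ : Set ℤ) ∧ f ∈ ω.2.2.1) ∨ (f 0 ∉ (Set.univ : Set ℤ) ∧ f ∈ ω.2.2.2.1); let blk : (Set ℤ × (Set ℤ × (Set (Literature.Probability.LatticeModels.Site 2) × (Set (Literature.Probability.LatticeModels.Site 2) × Set (Literature.Probability.LatticeModels.Site 2))))) → Literature.Probability.LatticeModels.Site 2 → Prop := fun ω v => Xor (v 0 ∈ ω.1) (Xor (v 1 ∈ ω.2.1) (Odd ((Finset.filter (fun f : ℤ × ℤ => par ω ![f.1, f.2]) (Finset.Ico (min 0 (v 0)) (max 0 (v 0)) ×ˢ Finset.Ico (min 0 (v 1)) (max 0 (v 1)))).card))); let anti : (Set ℤ × (Set ℤ × (Set (Literature.Probability.LatticeModels.Site 2) × (Set (Literature.Probability.LatticeModels.Site 2) × Set (Literature.Probability.LatticeModels.Site 2))))) → Literature.Probability.LatticeModels.Site 2 → Prop := fun ω f => f 0 ∉ (Set.univ : Set ℤ) ∨ f ∈ ω.2.2.2.2; let edges : (Set ℤ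 × (Set ℤ × (Set (Literature.Probability.LatticeModels.Site 2) × (Set (Literature.Probability.LatticeModels.Site 2) × Set (Literature.Probability.LatticeModels.Site 2))))) → Literature.Probability.Percolation.BondConfig (Literature.Probability.LatticeModels.Site 2) := fun ω => {e | ∃ u v, e = s(u, v) ∧ blk ω u ∧ blk ω v ∧ (v = u + ![1, 0] ∨ v = u + ![0, 1] ∨ (v = u + ![1, 1] ∧ ¬ anti ω u) ∨ (v = u + ![1, -1] ∧ anti ω (u + ![0, -1])))}; fun δ : ℝ => μ.real {ω | edges ω ∈ Literature.Probability.Percolation.embDomainCrossing (fun v : Literature.Probability.LatticeModels.Site 2 => ((v 0 : ℝ) : ℂ) + ((v 1 : ℝ) : ℂ) * Complex.I) R.carrier δ (R.arc 0) (R.arc 2)}); ∀ (R : Literature.Probability.RandomPlanarGeometry.ConformalRectangle) (L : ℝ), Filter.Tendsto (P (R.map (Homeomorph.mulLeft₀ Complex.I Complex.I_ne_zero))) (nhdsWithin 0 (Set.Ioi 0)) (nhds L) ↔ Filter.Tendsto (P R) (nhdsWithin 0 (Set.Ioi 0)) (nhds L)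

-- `IKQuarterTurn` holds: proved by `Summit.CriticalPhenomena.CardyFormulaZ2.Theorems.IKQuarterTurn.IKQuarterTurn_proof` (its module imports this route file, so no `_holds` link can be stated here).

/-- item stmt-CriticalPhenomena-4969 · support · rank 9 · closed · proved by Summit.CriticalPhenomena.CardyFormulaZ2.Theorems.anchorByRigidity_proof (prover) · by planner
sources: arXiv:2502.08394 (§5.4.2: the M = id interplay), arXiv:0708.3908 (Beffara2008Universal Prop. 4 and §2.2 "α_{T_s} = i"), tree: Literature.Barriers.CriticalPhenomena.EmbeddingModulusUniqueness_holds, arXiv:2012.11672 (DKKMO2020Rotational §4.1: group generation)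
[support] for ANY family P of crossing functions on conformal rectangles (read: the IK(π/2) crossing
probabilities, definition D2) that (a) has the same δ → 0⁺ limits on R and on its quarter-turn i·R
for every R, and (b) has the same limits as site-T percolation on the K-images R.map K for one
real-linear automorphism K of ℂ (the output of IKLinearTransport, r2), Smirnov's theorem implies: K
is a similarity and P has Cardy limits in every conformal rectangle. The two-ended rigidity of the
card (D₄ at IK, conformal at T), typed over the tree's MarkedDomain.map; provable now from
SimilarityRigidity, strictMonoOn_cardyFunction_holds, exists_isUniformizing_holds,
crossRatio_eq_of_isUniformizing_holds. [difficulty: provable-now] -/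
@[route_item "route-CriticalPhenomena-CardyIKTransport", crux]
def AnchorByRigidity : Prop :=
  Literature.Probability.Percolation.hasCrossingLimit_triDomainCrossingProb → ∀ (P : Literature.Probability.RandomPlanarGeometry.ConformalRectangle → ℝ → ℝ) (K : ℂ ≃L[ℝ] ℂ), (∀ (R : Literature.Probability.RandomPlanarGeometry.ConformalRectangle) (L : ℝ), Filter.Tendsto (P (R.map (Homeomorph.mulLeft₀ Complex.I Complex.I_ne_zero))) (nhdsWithin 0 (Set.Ioi 0)) (nhds L) ↔ Filter.Tendsto (P R) (nhdsWithin 0 (Set.Ioi 0)) (nhds L)) → (∀ (R : Literature.Probability.RandomPlanarGeometry.ConformalRectangle) (L : ℝ), Filter.Tendsto (P R) (nhdsWithin 0 (Set.Ioi 0)) (nhds L) ↔ Filter.Tendsto (Literature.Probability.Percolation.triDomainCrossingProb (R.map K.toHomeomorph)) (nhdsWithin 0 (Set.Ioi 0)) (nhds L)) → (∃ c : ℝ, 0 < c ∧ ∀ z : ℂ, ‖K z‖ = c * ‖z‖) ∧ ∀ R : Literature.Probability.RandomPlanarGeometry.ConformalRectangle, R.HasCrossingLimit (P R) Literature.Pr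obability.RandomPlanarGeometry.cardyFunction

-- `AnchorByRigidity` holds: proved by `Summit.CriticalPhenomena.CardyFormulaZ2.Theorems.anchorByRigidity_proof` (its module imports this route file, so no `_holds` link can be stated here).

/-- item stmt-CriticalPhenomena-4970 · support · rank 9 · closed · proved by Summit.CriticalPhenomena.CardyFormulaZ2.Theorems.similarityRigidity_proof (prover) · by planner
sources: arXiv:0708.3908 (Beffara2008Universal Prop. 4 and its proof p. 6), tree: Literature.Barriers.CriticalPhenomena.BeffaraShearDistortsModulus_holds, tree: Literature.Probability.RandomPlanarGeometry.MarkedDomain.map (ChordalCurveFamily.lean)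
[support] a real-linear automorphism E of ℂ that preserves the conformal modulus of every conformal
rectangle (uniformizing data of R and of R.map E have equal cross-ratios) is a similarity, ‖E z‖ =
c‖z‖. Pure plane conformal geometry: write E = s·u·φ_α (Beffara shear); Im α > 0, α ≠ i contradicts
BeffaraShearDistortsModulus_holds; Im α < 0 reduces to it by conjugation
(IsUniformizing.exists_conjugate, crossRatio_neg). Used by AnchorByRigidity with E = K ∘ (i·) ∘ K⁻¹.
[difficulty: provable-now] -/
@[route_item "route-CriticalPhenomena-CardyIKTransport"]
def SimilarityRigidity : Prop :=
  ∀ E : ℂ ≃L[ℝ] ℂ, (∀ (R : Literature.Probability.RandomPlanarGeometry.ConformalRectangle) (φ : Literature.Probability.RandomPlanarGeometry.ConformalEquiv UpperHalfPlane.upperHalfPlaneSet R.carrier) (x : Fin 4 → ℝ) (φ' : Literature.Probability.RandomPlanarGeometry.ConformalEquiv UpperHalfPlane.upperHalfPlaneSet (R.map E.toHomeomorph).carrier) (x' : Fin 4 → ℝ), R.IsUniformizing φ x → (R.map E.toHomeomorph).IsUniformizing φ' x' → Literature.Probability.RandomPlanarGeometry.crossRatio x = Literature.Probability.RandomPlanarGeometry.crossRatio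 x') → ∃ c : ℝ, 0 < c ∧ ∀ z : ℂ, ‖E z‖ = c * ‖z‖

-- `SimilarityRigidity` holds: proved by `Summit.CriticalPhenomena.CardyFormulaZ2.Theorems.similarityRigidity_proof` (its module imports this route file, so no `_holds` link can be stated here).

/-- item stmt-CriticalPhenomena-6432 · support · rank 9 · closed · proved by Summit.CriticalPhenomena.CardyFormulaZ2.Theorems.smirnovCardyTri_proof (prover) · by planner
sources: Smirnov2001, BollobasRiordan2006, tree: Literature.Probability.Percolation.hasCrossingLimit_triDomainCrossingProb_holds
[crux] Smirnov's theorem, the Literature named fact hasCrossingLimit_triDomainCrossingProb (Cardy's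
formula for site percolation on the triangular lattice at 1/2 in G02's discretisation triCrossing /
triDiscreteArc), filed as the FIRST crux because it is the one unproved fact of the import cone: the
flip calculus transfers Cardy from T, it cannot create it. [difficulty: XL] -/
@[route_item "route-CriticalPhenomena-CardyIKTransport", crux]
def SmirnovCardyTri : Prop :=
  Literature.Probability.Percolation.hasCrossingLimit_triDomainCrossingProb

-- `SmirnovCardyTri` holds: proved by `Summit.CriticalPhenomena.CardyFormulaZ2.Theorems.smirnovCardyTri_proof` (its module imports this route file, so no `_holds` link can be stated here).

/-! Retired items kept as plain definitions (history; not obligations of this route): landed proofs / closed glue still name them. -/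

/-- retired stmt-CriticalPhenomena-5077 (dropped, gen None) — proved by Summit.CriticalPhenomena.CardyFormulaZ2.Theorems.assembly2_proof @ 46fff5c91fc5. -/
def Assembly2 : Prop :=
  IKLinearTransport → CornerLineDescent → CrudeToCanonical → IKQuarterTurn → SmirnovCardyTri → AnchorByRigidity → CardyFormulaZ2

/-- item stmt-CriticalPhenomena-4971 · assembly · rank 1 · closed · proved by Summit.CriticalPhenomena.CardyFormulaZ2.Theorems.cardyIKTransport_assembly_proof @ 26cdd46311db (prover) · by planner
sources: Smirnov2001, arXiv:2502.08394, Beffara2008Universal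
[assembly] AnchorByRigidity → Smirnov (site-T Cardy, Literature fact as hypothesis) →
RenewalGridHarmless → CrudeToCanonical → ∀ P K, QuarterTurnInvariant P → LinearlyConjugateToTri P K
→ (Cardy P → product-grid bond Cardy) → CardyFormulaZ2. -/
@[route_item "route-CriticalPhenomena-CardyIKTransport"]
def Assembly : Prop :=
  AnchorByRigidity → Literature.Probability.Percolation.hasCrossingLimit_triDomainCrossingProb → RenewalGridHarmless → CrudeToCanonical → ∀ (P : Literature.Probability.RandomPlanarGeometry.ConformalRectangle → ℝ → ℝ) (K : ℂ ≃L[ℝ] ℂ), (∀ (R : Literature.Probability.RandomPlanarGeometry.ConformalRectangle) (L : ℝ), Filter.Tendsto (P (R.map (Homeomorph.mulLeft₀ Complex.I Complex.I_ne_zero))) (nhdsWithin 0 (Set.Ioi 0)) (nhds L) ↔ Filter.Tendsto (P R) (nhdsWithin 0 (Set.Ioi 0)) (nhds L)) → (∀ (R : Literature.Probability.RandomPlanarGeometry.ConformalRectangle) (L : ℝ), Filter.Tendsto (P R) (nhdsWithin 0 (Set.Ioi 0)) (nhds L) ↔ Filter.Tendsto (Literature.Probability.Percolation.triDomainCrossingProb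 (R.map K.toHomeomorph)) (nhdsWithin 0 (Set.Ioi 0)) (nhds L)) → ((∀ R : Literature.Probability.RandomPlanarGeometry.ConformalRectangle, R.HasCrossingLimit (P R) Literature.Probability.RandomPlanarGeometry.cardyFunction) → ∃ (a : ℝ) (s t : ℤ → ℝ), 0 < a ∧ StrictMono s ∧ StrictMono t ∧ Filter.Tendsto (fun i : ℤ => s i / (i : ℝ)) (Filter.cocompact ℤ) (nhds a) ∧ Filter.Tendsto (fun i : ℤ => t i / (i : ℝ)) (Filter.cocompact ℤ) (nhds a) ∧ ∀ R : Literature.Probability.RandomPlanarGeometry.ConformalRectangle, R.HasCrossingLimit (fun δ ↦ (Literature.Probability.Percolation.bondPercolation (Literature.Probability.LatticeModels.zdGraph 2) Literature.Probability.Percolation.half).real (Literature.Probability.Percolation.embDomainCrossing (fun v : Literature.Probability.LatticeModels.Site 2 ↦ (⟨s (v 0), t (v 1)⟩ : ℂ)) R.carrier δ (R.arc 0) (R.arc 2))) Literature.Probability.RandomPlanarGeometry.cardyFunction) → CardyFormulaZ2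

-- `Assembly` holds: proved by `Summit.CriticalPhenomena.CardyFormulaZ2.Theorems.cardyIKTransport_assembly_proof` @ 26cdd46311db (its module imports this route file, so no `_holds` link can be stated here).

-- records of items no longer active in this route (dropped / restated):
-- earlier Assembly2 (stmt-CriticalPhenomena-5077, dropped 2026-08-16T14:15:59Z): proved by Summit.CriticalPhenomena.CardyFormulaZ2.Theorems.assembly2_proof @ 46fff5c91fc5 — IKLinearTransport → CornerLineDescent → CrudeToCanonical → IKQuarterTurn → SmirnovCardyTri → AnchorByRigidity → CardyFormulaZ2

/-! D-0027 §2.1 — DECIDING THEOREM (planner-authored via `route open/edit --closes-file`; by planner-rbadge-CriticalPhenomena-CardyIKTransp-8c4bea11-g4-0 2026-08-15T16:58:44Z):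
its hypotheses are this route's items and its conclusion the sub-problem Statement (glue_lint), and it elaborates with this file. -/

@[closes "route-CriticalPhenomena-CardyIKTransport"] theorem closes : IKLinearTransport → CornerLineDescent → CrudeToCanonical → IKQuarterTurn → SmirnovCardyTri → AnchorByRigidity → _root_.CardyFormulaZ2 := by
  intro hlin hdesc hcrude hqt hsm hanchor
  obtain ⟨K, hK⟩ := hlin
  have hA := hanchor hsm
  specialize hA _ K ?qt hK
  · exact hqt
  exact hcrude (hdesc hA.2)

end Summit.CriticalPhenomena.CardyFormulaZ2.Theses.CardyIKTransport
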